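import Summits.ResolutionOfSingularities.ResolutionOfSingularities.Theorems.FrobeniusClosingSteerCriticalThread
import Summits.ResolutionOfSingularities.ResolutionOfSingularities.Theorems.FrobeniusClosingSteerCriticalThreadStep
import Summits.ResolutionOfSingularities.ResolutionOfSingularities.Theorems.FrobeniusClosingSteerCriticalThreadForms
import Literature.AlgebraicGeometry.Resolution.RsopPartOfRegularSequence
import Literature.AlgebraicGeometry.Resolution.RegularSystemOfParameters
import HarnessLib

/-!
# Crux `Steer` (stmt-ResolutionOfSingularities-16345), chain W4.1, LOW branch §σ2.24 D3a (A2): **(B3) the critical-surface THREAD —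
# UNCONDITIONAL run-level induction** (`criticalThread` of `…SteerCriticalThread` with its one-step hypothesis DISCHARGED by
# res-L0-w41-stub-3's `CriticalThread.thread_step` / `pointStep_form` / `curveStep_form`)

OURS (campaign `res-hironaka`, rung L ★L-G4, slot W4.1; seat res-type-096 g9 on res-L0-w41-plan-1 RULINGS 96 / 109 (2); replaces the
role of no printed item; NOT a statement of the manuscript under review [claim: Hironaka2017, status: under-review]; AI-produced, weaker
than expert review). Theses-free and definition-free.

* `isRsopPart_fin_zero` — the empty family is part of a regular system of parameters of a regular local ring;
  `add_le_of_isRsopPart`, `span_range_eq_maximalIdeal_of_isRsopPart` — a part of a regular system of parameters has length `≤ dim`, and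
  generates `𝔪` when its length is `dim`.
* `criticalThreadStep_of_thread_step` — the one-step statement in the binder shape of `CriticalThread.criticalThread`'s hypothesis
  `hstep` (statement of record ce41c1df407c1344), PROVED from stub-3's `thread_step`: at a POINT step the Jacobian pair `(δ₁ f, δ₂ f)`
  is completed to a regular system of parameters (`IsRsopPart.exists_rsop`); at a PERMISSIBLE step it is completed to a nested part
  generating the centre (`exists_isRsopPart_append_span_eq`, the pair lies in `P` because `f − g² ∈ P²` and derivations map `P²` into
  `P`); the chart clauses come from `pointStep_form` / `curveStep_form`, the curve case being forced by the LENGTH ANALYSIS of the nested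
  part `y : Fin (2 + r)`: `r = 0` is a surface step along the critical surface — impossible, `x ∈ P = 𝔮` would be a non-unit of `Λ`
  against `thread_step`'s `IsUnit x`; `2 + r ≤ dim R = 4`; `r = 2` forces `P = 𝔪` — so `r = 1`, a curve.
* `criticalThread_run` — `hthread ∧ hinv` of res-D-pv-012's `exists_lowTower`, UNCONDITIONALLY from the unfolded run data.

[cite: Cutkosky2014, §2.1] [cite: Matsumura1987, Thm. 14.2] [cite: NovacoskiSpivakovsky2014, Def. 2.11] [folklore]
-/

noncomputable section

-- `Summit.<S>.<S>.…` duplicates the summit name by design (single-problem summit).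
set_option linter.dupNamespace false

open IsLocalRing

namespace Summit.ResolutionOfSingularities.ResolutionOfSingularities.Theorems.SwitchingDichotomy

open Literature.AlgebraicGeometry.Resolution

namespace CriticalThread

variable {K : Type} [Field K]

/-! ## §1 Small facts on parts of regular systems of parameters -/

/-- The empty family is part of a regular system of parameters of a regular local ring. [cite: Matsumura1987, §14] -/
theorem isRsopPart_fin_zero {A : Type*} [CommRing A] [IsRegularLocalRing A] (z : Fin 0 → A) : IsRsopPart z := by
  obtain ⟨x, hx⟩ := exists_regularSystemOfParameters (R := A)
  refine ⟨inferInstance, (maximalIdeal A).spanFinrank, x, ?_, ?_⟩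
  · rw [zero_add]
    exact (IsRegularLocalRing.spanFinrank_maximalIdeal (R := A)).symm
  · rw [Set.range_eq_empty z, Set.empty_union, hx]

/-- A part of a regular system of parameters of length `n` in a local ring of dimension `d` has `n ≤ d`, and generates the maximal
ideal when `n = d`. [cite: Matsumura1987, Thm. 14.2] -/
theorem le_and_span_eq_of_isRsopPart {A : Type*} [CommRing A] [IsLocalRing A] {n : ℕ} {z : Fin n → A}
    (hz : IsRsopPart z) {d : ℕ} (hd : ringKrullDim A = (d : ℕ)) :
    n ≤ d ∧ (n = d → Ideal.span (Set.range z) = maximalIdeal A) := by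
  obtain ⟨_, e, w, hdim, hspan⟩ := hz
  rw [hd] at hdim
  have hde : d = n + e := by exact_mod_cast hdim
  refine ⟨by omega, fun hnd => ?_⟩
  have he : e = 0 := by omega
  subst he
  rw [Set.range_eq_empty w, Set.union_empty] at hspan
  exact hspan

/-- A `ℤ`-derivation maps `P²` into `P`. [folklore] -/
theorem derivation_apply_mem_of_mem_sq {A : Type*} [CommRing A] (D : Derivation ℤ A A) (P : Ideal A) {a : A}
    (ha : a ∈ P ^ 2) : D a ∈ P := by
  rw [pow_two] at ha
  refine Submodule.mul_induction_on ha (fun y hy z hz => ?_) (fun y z hy hz => ?_)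
  · rw [D.leibniz, smul_eq_mul, smul_eq_mul]
    exact P.add_mem (P.mul_mem_right _ hy) (P.mul_mem_right _ hz)
  · rw [map_add]
    exact P.add_mem hy hz

/-! ## §2 The one-step statement of `criticalThread`'s hypothesis, from stub-3's `thread_step` -/

/-- **(B2b) in the binder shape of `CriticalThread.criticalThread`'s hypothesis `hstep`** (statement of record ce41c1df407c1344), PROVED
from res-L0-w41-stub-3's `CriticalThread.thread_step` + `pointStep_form` + `curveStep_form`: completion of the Jacobian pair to a nested
part of a regular system of parameters generating the centre, and the length analysis `r = 1` at a permissible step (see the module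
docstring). OURS. [cite: Matsumura1987, Thm. 14.2] [folklore] -/
theorem criticalThreadStep_of_thread_step [CharP K 2] (O : ValuationSubring K)
    (R R' : Subring K) [IsRegularLocalRing R] [IsRegularLocalRing R']
    (hRO : SubringDominates R O.toSubring) (hdim : ringKrullDim R = (4 : ℕ)) (_hdim' : ringKrullDim R' = (4 : ℕ))
    (_hperf : ∀ a : R, ∃ b : R, a - b ^ 2 ∈ maximalIdeal R)
    (P : Ideal R) (hbl : IsLocalBlowupAlong O R P R')
    (s s' x G : K) (hs : s ^ 2 ∈ R) (hs' : s' ^ 2 ∈ R')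
    (hP : P = maximalIdeal R ∨
      (P ≠ maximalIdeal R ∧ P.IsPrime ∧ IsRegularLocalRing (R ⧸ P) ∧ ∃ g : R, (⟨s ^ 2, hs⟩ : R) - g ^ 2 ∈ P ^ 2))
    (hxP : ∃ hxR : x ∈ R, (⟨x, hxR⟩ : R) ∈ P) (hx0 : x ≠ 0)
    (hxmax : ∀ y : R, y ∈ P → O.valuation (y : K) ≤ O.valuation x)
    (hG : G ∈ R) (hstep : s = x * s' + G)
    (hsing : ∃ γ : R', (⟨s' ^ 2, hs'⟩ : R') - γ ^ 2 ∈ maximalIdeal R' ^ 2)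
    (Λ : Subring K) (hle : R ≤ Λ) (δ₁ δ₂ : Derivation ℤ R R)
    (h2 : ∀ r (hr : r ∈ R), (⟨r, hr⟩ : R) ∉ Ideal.span {δ₁ ⟨s ^ 2, hs⟩, δ₂ ⟨s ^ 2, hs⟩} → r⁻¹ ∈ Λ)
    (h4 : ∀ z ∈ Λ, ∃ a u : K, ∃ (_ : a ∈ R) (hu : u ∈ R),
      (⟨u, hu⟩ : R) ∉ Ideal.span {δ₁ ⟨s ^ 2, hs⟩, δ₂ ⟨s ^ 2, hs⟩} ∧ z = a / u)
    (htrace : ∀ r : R, r ∈ Ideal.span {δ₁ ⟨s ^ 2, hs⟩, δ₂ ⟨s ^ 2, hs⟩} ↔ ¬ IsUnit (⟨(r : K), hle r.2⟩ : Λ))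
    (hrsop : IsRsopPart ![δ₁ ⟨s ^ 2, hs⟩, δ₂ ⟨s ^ 2, hs⟩])
    (hHess : IsUnit (δ₁ (δ₁ ⟨s ^ 2, hs⟩) * δ₂ (δ₂ ⟨s ^ 2, hs⟩) - δ₁ (δ₂ ⟨s ^ 2, hs⟩) * δ₂ (δ₁ ⟨s ^ 2, hs⟩))) :
    ∃ hle' : R' ≤ Λ,
      (∃ δ₁' δ₂' : Derivation ℤ R' R',
        (∀ r : R', r ∈ Ideal.span {δ₁' ⟨s' ^ 2, hs'⟩, δ₂' ⟨s' ^ 2, hs'⟩} ↔ ¬ IsUnit (⟨(r : K), hle' r.2⟩ : Λ)) ∧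
        IsRsopPart ![δ₁' ⟨s' ^ 2, hs'⟩, δ₂' ⟨s' ^ 2, hs'⟩] ∧
        IsUnit (δ₁' (δ₁' ⟨s' ^ 2, hs'⟩) * δ₂' (δ₂' ⟨s' ^ 2, hs'⟩) -
          δ₁' (δ₂' ⟨s' ^ 2, hs'⟩) * δ₂' (δ₁' ⟨s' ^ 2, hs'⟩))) ∧
      (P = maximalIdeal R →
        (∀ y (hy : y ∈ R), ¬ IsUnit (⟨y, hy⟩ : R) → y / x ∈ O) ∧ R' = locAtCentre (blowupRing R x) O) ∧
      (P ≠ maximalIdeal R → ∃ S : Finset K, (↑S : Set K) ⊆ ↑O ∧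
        (∀ z ∈ S, ∃ r ∈ R, ∃ hzr : z - r ∈ Λ, ¬ IsUnit (⟨z - r, hzr⟩ : Λ)) ∧
        R' = locAtCentre (Subring.closure ((R : Set K) ∪ ↑S)) O) := by
  classical
  obtain ⟨hxR, hxPmem⟩ := hxP
  -- valuation form of the domination, locality of `Λ`
  have hval : ∀ a : R, a ∈ maximalIdeal R ↔ O.valuation (a : K) < 1 :=
    (subringDominates_valuationSubring_iff hRO.1).mp hRO
  have hprime : (Ideal.span {δ₁ ⟨s ^ 2, hs⟩, δ₂ ⟨s ^ 2, hs⟩}).IsPrime := by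
    have h := hrsop.isPrime_span_range
    rwa [Matrix.range_cons, Matrix.range_cons, Matrix.range_empty, Set.union_empty, Set.singleton_union] at h
  haveI : IsLocalRing Λ := LowTower.isLocalRing_of_locAtPrime R Λ _ hle h2 h4
  rcases hP with hPm | ⟨hPne, hPr, hPreg, g, hg⟩
  · -- ### POINT STEP: complete the pair to a regular system of parameters
    obtain ⟨r, y, hd, hyspan, hy01⟩ := hrsop.exists_rsop
    have hy : IsRsopPart y := isRsopPart_comp_of_rsop hd y hyspan id Function.injective_id
    have hyP : Ideal.span (Set.range y) = P := by rw [hyspan, hPm]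
    have hy0 : y (Fin.castAdd r 0) = δ₁ ⟨s ^ 2, hs⟩ := by rw [hy01]; rfl
    have hy1 : y (Fin.castAdd r 1) = δ₂ ⟨s ^ 2, hs⟩ := by rw [hy01]; rfl
    obtain ⟨-, hR', -, -, hle', δ₁', δ₂', -, -, htr', hrs', hH'⟩ :=
      thread_step hval hle hs hs' δ₁ δ₂ htrace hHess hy hyP hy0 hy1 hbl hxR hxPmem hx0 hxmax hG hstep hsing
    exact ⟨hle', ⟨δ₁', δ₂', htr', hrs', hH'⟩, fun _ => pointStep_form hPm hxmax hx0 hR', fun hne => absurd hPm hne⟩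
  · -- ### PERMISSIBLE STEP: complete the pair to a nested part generating the centre
    haveI := hPr
    haveI := hPreg
    -- the Jacobian pair lies in `P` (`f − g² ∈ P²`, derivations map `P²` into `P`, `2 = 0`)
    have h2K : (2 : K) = 0 := by
      have h := CharP.cast_eq_zero K 2
      rwa [Nat.cast_ofNat] at h
    have h2R : (2 : R) = 0 := Subtype.ext (by push_cast; exact h2K)
    have hDP : ∀ D : Derivation ℤ R R, D ⟨s ^ 2, hs⟩ ∈ P := by
      intro D
      have hDg : D (g ^ 2) = 0 := by
        rw [D.leibniz_pow, nsmul_eq_mul, Nat.cast_ofNat, h2R, zero_mul]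
      have heq : D ⟨s ^ 2, hs⟩ = D ((⟨s ^ 2, hs⟩ : R) - g ^ 2) := by rw [map_sub, hDg, sub_zero]
      rw [heq]
      exact derivation_apply_mem_of_mem_sq D P hg
    have haP : ∀ k, (![δ₁ ⟨s ^ 2, hs⟩, δ₂ ⟨s ^ 2, hs⟩]) k ∈ P := by
      intro k
      fin_cases k
      · exact hDP δ₁
      · exact hDP δ₂
    obtain ⟨r, c, -, hyc, hspan⟩ := exists_isRsopPart_append_span_eq (J := P) (b := (Fin.elim0 : Fin 0 → R))
      hrsop haP (fun k => k.elim0) (isRsopPart_fin_zero _)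
    have hy : IsRsopPart (Fin.append ![δ₁ ⟨s ^ 2, hs⟩, δ₂ ⟨s ^ 2, hs⟩] c) := hyc.append_left
    have hy0 : Fin.append ![δ₁ ⟨s ^ 2, hs⟩, δ₂ ⟨s ^ 2, hs⟩] c (Fin.castAdd r 0) = δ₁ ⟨s ^ 2, hs⟩ := by
      rw [Fin.append_left]; rfl
    have hy1 : Fin.append ![δ₁ ⟨s ^ 2, hs⟩, δ₂ ⟨s ^ 2, hs⟩] c (Fin.castAdd r 1) = δ₂ ⟨s ^ 2, hs⟩ := by
      rw [Fin.append_left]; rfl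
    obtain ⟨hxu, hR', -, -, hle', δ₁', δ₂', hE₁, hE₂, htr', hrs', hH'⟩ :=
      thread_step hval hle hs hs' δ₁ δ₂ htrace hHess hy hspan hy0 hy1 hbl hxR hxPmem hx0 hxmax hG hstep hsing
    refine ⟨hle', ⟨δ₁', δ₂', htr', hrs', hH'⟩, fun hPm => absurd hPm hPne, fun _ => ?_⟩
    -- ### length analysis: `r = 1`
    have hlen := le_and_span_eq_of_isRsopPart hy hdim
    have hr0 : r ≠ 0 := by
      intro h0
      subst h0
      -- `P = (δ₁ f, δ₂ f)`: the exceptional parameter would be a non-unit of `Λ`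
      have hrange : Set.range (Fin.append ![δ₁ ⟨s ^ 2, hs⟩, δ₂ ⟨s ^ 2, hs⟩] c) =
          {δ₁ ⟨s ^ 2, hs⟩, δ₂ ⟨s ^ 2, hs⟩} := by
        ext a
        constructor
        · rintro ⟨i, rfl⟩
          refine Fin.addCases (fun j => ?_) (fun j => j.elim0) i
          rw [Fin.append_left]
          fin_cases j
          · exact Or.inl rfl
          · exact Or.inr rfl
        · rintro (rfl | rfl)
          · exact ⟨Fin.castAdd 0 0, by rw [Fin.append_left]; rfl⟩
          · exact ⟨Fin.castAdd 0 1, by rw [Fin.append_left]; rfl⟩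
      have hxq : (⟨x, hxR⟩ : R) ∈ Ideal.span {δ₁ ⟨s ^ 2, hs⟩, δ₂ ⟨s ^ 2, hs⟩} := by
        rw [← hrange, hspan]
        exact hxPmem
      exact ((htrace ⟨x, hxR⟩).mp hxq) hxu
    have hr2 : r ≠ 2 := by
      intro h2
      subst h2
      exact hPne (hspan ▸ hlen.2 rfl)
    obtain rfl : r = 1 := by omega
    exact curveStep_form hRO.1 hval hle hbl.isLocalBlowup.le hle' hspan hy0 hy1 hxR hxPmem hx0 hxmax hR' hE₁ hE₂ htr'

/-! ## §3 The thread, unconditionally -/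

/-- **(B3) THE CRITICAL-SURFACE THREAD — UNCONDITIONAL.** `CriticalThread.criticalThread` (run-level induction, p527756) with its one-step
hypothesis discharged by `criticalThreadStep_of_thread_step` (res-L0-w41-stub-3's `thread_step` p527260 + forms p527478): along the
sub-run `R (i₀ + ·)` of a σ_top-steered `2`-torsor run in characteristic `2` (members regular local of dimension `4`, dominated by `O`,
residues squares, every stage singular), from the (A1′) Jacobian pair at `i₀` and `Λ = (R i₀)_𝔮₀`, the THREADING `hthread` and the
INVARIANT `hinv` of res-D-pv-012's `exists_lowTower` hold at every stage. OURS. [cite: Cutkosky2014, §2.1] [folklore] -/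
theorem criticalThread_run [CharP K 2]
    (O : ValuationSubring K) (R : ℕ → Subring K) (P : (i : ℕ) → Ideal (R i)) (s : ℕ → K) (i₀ : ℕ)
    (hreg : ∀ n, IsRegularLocalRing (R (i₀ + n)))
    (hRO : ∀ n, SubringDominates (R (i₀ + n)) O.toSubring)
    (hdim : ∀ n, ringKrullDim (R (i₀ + n)) = (4 : ℕ))
    (hperf : ∀ n (a : R (i₀ + n)), ∃ b : R (i₀ + n), a - b ^ 2 ∈ maximalIdeal (R (i₀ + n)))
    (hs2 : ∀ n, s (i₀ + n) ^ 2 ∈ R (i₀ + n))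
    (hrun : ∀ n,
      (P (i₀ + n) = maximalIdeal (R (i₀ + n)) ∨
        (P (i₀ + n) ≠ maximalIdeal (R (i₀ + n)) ∧ (P (i₀ + n)).IsPrime ∧
          IsRegularLocalRing (R (i₀ + n) ⧸ P (i₀ + n)) ∧
          ∃ g : R (i₀ + n), (⟨s (i₀ + n) ^ 2, hs2 n⟩ : R (i₀ + n)) - g ^ 2 ∈ P (i₀ + n) ^ 2)) ∧
      IsLocalBlowupAlong O (R (i₀ + n)) (P (i₀ + n)) (R (i₀ + n + 1)) ∧
      ∃ x G : K, (∃ hx : x ∈ R (i₀ + n), (⟨x, hx⟩ : R (i₀ + n)) ∈ P (i₀ + n)) ∧ x ≠ 0 ∧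
        (∀ y : R (i₀ + n), y ∈ P (i₀ + n) → O.valuation (y : K) ≤ O.valuation x) ∧
        G ∈ R (i₀ + n) ∧ s (i₀ + n) = x * s (i₀ + n + 1) + G)
    (hsing : ∀ n, ∃ γ : R (i₀ + n), (⟨s (i₀ + n) ^ 2, hs2 n⟩ : R (i₀ + n)) - γ ^ 2 ∈ maximalIdeal (R (i₀ + n)) ^ 2)
    (Λ : Subring K) (h1 : R (i₀ + 0) ≤ Λ) (δ₁ δ₂ : Derivation ℤ (R (i₀ + 0)) (R (i₀ + 0)))
    (h2 : ∀ r (hr : r ∈ R (i₀ + 0)), (⟨r, hr⟩ : R (i₀ + 0)) ∉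
      Ideal.span {δ₁ ⟨s (i₀ + 0) ^ 2, hs2 0⟩, δ₂ ⟨s (i₀ + 0) ^ 2, hs2 0⟩} → r⁻¹ ∈ Λ)
    (h4 : ∀ z ∈ Λ, ∃ a u : K, ∃ (_ : a ∈ R (i₀ + 0)) (hu : u ∈ R (i₀ + 0)),
      (⟨u, hu⟩ : R (i₀ + 0)) ∉ Ideal.span {δ₁ ⟨s (i₀ + 0) ^ 2, hs2 0⟩, δ₂ ⟨s (i₀ + 0) ^ 2, hs2 0⟩} ∧ z = a / u)
    (hrsop₀ : IsRsopPart ![δ₁ ⟨s (i₀ + 0) ^ 2, hs2 0⟩, δ₂ ⟨s (i₀ + 0) ^ 2, hs2 0⟩])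
    (hHess₀ : IsUnit (δ₁ (δ₁ ⟨s (i₀ + 0) ^ 2, hs2 0⟩) * δ₂ (δ₂ ⟨s (i₀ + 0) ^ 2, hs2 0⟩) -
      δ₁ (δ₂ ⟨s (i₀ + 0) ^ 2, hs2 0⟩) * δ₂ (δ₁ ⟨s (i₀ + 0) ^ 2, hs2 0⟩)))
    (pt : Set ℕ) (hpt : ∀ n, n ∈ pt ↔ P (i₀ + n) = maximalIdeal (R (i₀ + n))) :
    (∀ n : ℕ, R (i₀ + n) ≤ Λ ∧ SubringDominates (R (i₀ + n)) (R (i₀ + n + 1)) ∧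
      ∃ x G : K, ∃ hx : x ∈ R (i₀ + n), G ∈ R (i₀ + n) ∧ x ≠ 0 ∧ ¬ IsUnit (⟨x, hx⟩ : R (i₀ + n)) ∧
        s (i₀ + n) = x * s (i₀ + n + 1) + G ∧
        (n ∈ pt → (∀ y (hy : y ∈ R (i₀ + n)), ¬ IsUnit (⟨y, hy⟩ : R (i₀ + n)) → y / x ∈ O) ∧
          ∀ hl : IsLocalRing (R (i₀ + n)), R (i₀ + n + 1) = locAtCentre (@blowupRing K _ (R (i₀ + n)) hl x) O) ∧
        (n ∉ pt → ∃ S : Finset K, (↑S : Set K) ⊆ ↑O ∧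
          (∀ z ∈ S, ∃ r ∈ R (i₀ + n), ∃ hzr : z - r ∈ Λ, ¬ IsUnit (⟨z - r, hzr⟩ : Λ)) ∧
          R (i₀ + n + 1) = locAtCentre (Subring.closure ((R (i₀ + n) : Set K) ∪ ↑S)) O)) ∧
    (∀ n : ℕ, ∃ (hle : R (i₀ + n) ≤ Λ) (_hl : IsLocalRing (R (i₀ + n))) (hs : s (i₀ + n) ^ 2 ∈ R (i₀ + n))
      (δ₁ δ₂ : Derivation ℤ (R (i₀ + n)) (R (i₀ + n))),
      (∀ r : R (i₀ + n), r ∈ Ideal.span {δ₁ ⟨s (i₀ + n) ^ 2, hs⟩, δ₂ ⟨s (i₀ + n) ^ 2, hs⟩} ↔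
        ¬ IsUnit (⟨(r : K), hle r.2⟩ : Λ)) ∧
      IsRsopPart ![δ₁ ⟨s (i₀ + n) ^ 2, hs⟩, δ₂ ⟨s (i₀ + n) ^ 2, hs⟩] ∧
      IsUnit (δ₁ (δ₁ ⟨s (i₀ + n) ^ 2, hs⟩) * δ₂ (δ₂ ⟨s (i₀ + n) ^ 2, hs⟩) -
        δ₁ (δ₂ ⟨s (i₀ + n) ^ 2, hs⟩) * δ₂ (δ₁ ⟨s (i₀ + n) ^ 2, hs⟩))) :=
  criticalThread O R P s i₀ hreg hRO hdim hperf hs2 hrun hsing Λ h1 δ₁ δ₂ h2 h4 hrsop₀ hHess₀ pt hpt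
    (fun R R' _ _ hRO' hd hd' hperf' P hbl s s' x G hs hs' hP hxP hx0 hxmax hG hst hsg Λ' hle D₁ D₂ h2' h4' htr hrs hH =>
      criticalThreadStep_of_thread_step O R R' hRO' hd hd' hperf' P hbl s s' x G hs hs' hP hxP hx0 hxmax hG hst hsg Λ' hle
        D₁ D₂ h2' h4' htr hrs hH)

end CriticalThread

end Summit.ResolutionOfSingularities.ResolutionOfSingularities.Theorems.SwitchingDichotomy

end
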